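import Summits.QuantumFields.YangMills.Theorems.BalabanUVNodesN06AtRecord11SixPin

/-!
# BalabanUVNodes ∕ N06 ([B9], `Dag.B9_main`) — THE ∀-FORM STUBS OVER THE STAGE-11 CARRIER RECORDS ARE FALSE OF RECORD (guard, referee ref-E's J2 witness
# landed by name): one DIVERGENT operator layer refutes def-Y's extended leaf, so `S_N06 (₁₁CB10YZW)`, `S_N06 (…B8B12)`, `S_N06 (…B8subB12)` and the bundle slot fail

Track A of `YM-PLAN.md` (cell `pub-ymgap`, HUMAN RULING D-0062), node **N06** = [Balaban1985BackgroundPropagators] Thms 3.1–3.15; seat `pub-ymgap-dag-n06-d` gen 2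
(N06-ASSIGNMENT v1 (P3) «THE KNIT AT THE RECORD»).  Referee ref-E's act-(iv) READ-9 of p457256 ∕ p457259 (pub-ymgap STATUS l.6768, probe `READS/n06obligations-probe.g0.lean`
08838204ca5554f3) PASSED both files and recommended that the seat land its J2 WITNESS by name: the bundle-slot hypothesis
`hslot : ∀ θ₃, θ₃.toStage1Params.Admissible → ∀ M⋆ ops, B9LeafX (Y9OfRecord N θ₃ M⋆ ops)` of the ∀-currency closers (`s_N06_record₁₁CB10YZW_of_bundleSlot`,
`s_N06_of_refines₁₁CB10YZW(B8)`, `s_N06_record₁₁CB10YZWB8B12_of_bundleSlot`, `…B8subB12_of_bundleSlot`) is UNSATISFIABLE, and the `hbad` of the landed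
`N06AtRecord11CB10YZW.not_s_N06_record₁₁CB10YZW_of_badOps` («Typed, not asserted: no bad layer is constructed here») is DISCHARGED by ONE explicit bad layer: a
given operator layer with its Theorem-3.7 expansion letter declared divergent at every configuration (`E37.Converges := fun _ => False`).  At such a layer
`B9.Thm37Printed` demands `False` at some member — members of arbitrarily large `M` exist (`memberY_unbounded_M`, `L ≥ 5`), `α₀ := a₀ ∕ M` is admissible and `U = 1` is
(3.35)-regular (`reg335Y_one`) — so the extended leaf fails, and every ∀-form over a record family whose members are presented by arbitrary operator layers fails with it.
This is the N06 twin of ref-A's N05 guard `not_s_N05_record₁₁CB10YZWB8`.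

WHAT THIS MODULE PROVES (kernel bookkeeping; 0 `def` — the bad layer is an inline structure update; 0 `sorry`; standard axioms; COUNT-NEUTRAL, `--supports` K1):
* §1 `not_thm37Printed_of_divergent` · `not_b9LeafX_of_divergent` · `exists_ops_not_b9LeafX` (from def-Y's junk layer `exists_junkOps_b9LeafX_Y9OfRecord`, made
  divergent) · `bundleSlot_unsat`.
* §2 `not_s_N06_record₁₁CB10YZW` — the four-pin ∀-form stub is FALSE as soon as one admissible Stage-11 parameter with provisos, `γ > 0` and `L ≥ 5` exists (g0's
  `not_s_N06_record₁₁CB10YZW_of_badOps` with `hbad` discharged); `not_s_N06_record₁₁CB10YZWB8B12` · `not_s_N06_record₁₁CB10YZWB8subB12` — the same at g32's six-pin records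
  (the world presented by the bad layer is built as in g32's `exists_world_…`, its `b9` leaf read by `upOfRecord₅CS_view₁₁B12B8(sub)B10YZW_leaves`, the in-edges by
  `b4_b5_b6_b7_of_…`).

HONEST FRAMING.  What is refuted is the ∀-FORM STUB `YMDAG.UVSplit.S_N06 Rec` over record predicates that quantify over a HIDDEN operator layer — never an N06 target
(`N06AtRecord11CB10YZW` §3, ref-A's clause of record) and NOT the route's K1 item (`StabilityBAtRecordR11e`, ∃-currency: the prover CHOOSES the package; the pointed faces
`b9_main_of_up_view₁₁…` and the knit chain `…_W38T314SectBnsupplied` are untouched and remain the non-vacuous content).  [B9] itself is neither proved nor refuted for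
Bałaban's operators; N06 is NOT discharged and NOT refuted; counts unmoved.  One finite four-torus programme at fixed `ε` — NOT ℝ⁴, NOT OS, NOT a mass gap, NOT Clay.
Adapted from referee ref-E's probe (RefE.Read9), with the `def badOf` replaced by an inline structure update.
-/

noncomputable section

namespace Summit.QuantumFields.YangMills.BalabanUVNodes.N06AtRecord11ForallGuard

open Literature.MathematicalPhysics.QuantumFieldTheory.Balaban1983to89
open Literature.MathematicalPhysics.QuantumFieldTheory.Balaban1983to89.T4Continuum (T4Family FiniteEpsData)
open Literature.MathematicalPhysics.QuantumFieldTheory.Balaban1983to89.DagBinding (WorldP leavesP B9LeafX)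
open Literature.MathematicalPhysics.QuantumFieldTheory.Balaban1983to89.Node00
open Literature.MathematicalPhysics.QuantumFieldTheory.Balaban1983to89.B9PinMembersKLevelV1 (MemberY geo9Y bg9Y memberY_unbounded_M reg335Y_one)
open Literature.MathematicalPhysics.QuantumFieldTheory.Balaban1983to89.B9PinGeometryKLevelV1 (c35Y c35Y_pos)
open Literature.MathematicalPhysics.QuantumFieldTheory.Balaban1983to89.B7Prop2SpecialUnitary (specialUnitaryUnits)
open YMDAG.UVSplit (RecordPred Datum AtRecord S_N06)
open Summit.QuantumFields.YangMills.BalabanUVNodes.N06AtRecord9CB10Y (exists_junkOps_b9LeafX_Y9OfRecord)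
open Summit.QuantumFields.YangMills.BalabanUVNodes.N06AtRecord11CB10YZW (not_s_N06_record₁₁CB10YZW_of_badOps)
open scoped Matrix.Norms.L2Operator

variable {N : ℕ} [NeZero N]

/-! ## §1 a divergent Theorem-3.7 letter refutes the extended leaf; the bundle slot is unsatisfiable -/

section AtBundle

variable (θ₃ : Stage3Params) (Mstar : ℕ)

/-- **`B9.Thm37Printed` FAILS for an operator layer whose (3.90)-expansion letter is divergent at every configuration** (on every Stage-3 geometry with `L ≥ 5`):
the printed sentence «∃ M₂ a₀ > 0, ∀ i, M₂ ≤ M_i → ∀ α₀ > 0, M_iα₀ ≤ a₀ → ∀ U (3.35)-regular, (E i).Converges U» is met by a member with `M₂ ≤ M` (`memberY_unbounded_M`),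
`α₀ := a₀ ∕ M` and `U := 1` (`reg335Y_one`), where it demands the divergent letter to converge. [cite: Balaban1985BackgroundPropagators, Thm 3.7 p.409 (the typed sentence); Thm 3.1 p.397 («for M ≥ M₁»), Cor. 3.5 p.407 («U = 1»)] -/
theorem not_thm37Printed_of_divergent (ops : OpsY N θ₃ Mstar) (hℓ : 4 ≤ θ₃.ℓ₆)
    (hdiv : ∀ (x : MemberY θ₃.d₆ θ₃.ℓ₆ θ₃.hd' θ₃.hL' θ₃.b₀ θ₃.b₁ Mstar) (U : (bg9Y (Matrix (Fin N) (Fin N) ℂ) (specialUnitaryUnits (Fin N)) x).Cfg),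
      ¬ ((ops x).E37).Converges U) :
    ¬ B9.Thm37Printed c35Y geo9Y (bg9Y (Matrix (Fin N) (Fin N) ℂ) (specialUnitaryUnits (Fin N))) (fun x => (ops x).E37) := by
  -- adapted from referee ref-E's probe `RefE.Read9.refE_not_thm37_badOf`
  rintro ⟨M₂, a₀, hM₂, ha₀, H⟩
  obtain ⟨x, hx⟩ := memberY_unbounded_M (d := θ₃.d₆) (hd := θ₃.hd') (hL := θ₃.hL') (Mstar := Mstar) hℓ θ₃.hb.1 θ₃.hb.2 M₂
  have hMpos : 0 < (geo9Y x).M := hM₂.trans_le hx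
  have hα : 0 < a₀ / (geo9Y x).M := div_pos ha₀ hMpos
  have hMa : (geo9Y x).M * (a₀ / (geo9Y x).M) ≤ a₀ := by rw [mul_div_cancel₀ _ hMpos.ne']
  exact hdiv x _ (H x hx _ hα hMa _ (reg335Y_one x c35Y_pos hα))

/-- **… hence def-Y's extended leaf FAILS at such a layer** (its field `numbered.t37` is `B9.Thm37Printed … (fun x => (ops x).E37)`).
[cite: Balaban1985BackgroundPropagators, Thm 3.7 p.409 (bookkeeping)] -/
theorem not_b9LeafX_of_divergent (ops : OpsY N θ₃ Mstar) (hℓ : 4 ≤ θ₃.ℓ₆)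
    (hdiv : ∀ (x : MemberY θ₃.d₆ θ₃.ℓ₆ θ₃.hd' θ₃.hL' θ₃.b₀ θ₃.b₁ Mstar) (U : (bg9Y (Matrix (Fin N) (Fin N) ℂ) (specialUnitaryUnits (Fin N)) x).Cfg),
      ¬ ((ops x).E37).Converges U) :
    ¬ B9LeafX (Y9OfRecord N θ₃ Mstar ops) :=
  fun hL => not_thm37Printed_of_divergent θ₃ Mstar ops hℓ hdiv hL.numbered.t37

/-- **A BAD OPERATOR LAYER EXISTS at every admissible Stage-3 parameter with `L ≥ 5` and every floor**: def-Y's junk layer (`exists_junkOps_b9LeafX_Y9OfRecord`) with its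
Theorem-3.7 letter's convergence predicate replaced by `False` (an inline structure update; nothing is defined). [cite: Balaban1985BackgroundPropagators, Thm 3.7 p.409 (bookkeeping: the typed leaf has refuting instances)] -/
theorem exists_ops_not_b9LeafX (hadm : θ₃.toStage1Params.Admissible) (hℓ : 4 ≤ θ₃.ℓ₆) :
    ∃ ops : OpsY N θ₃ Mstar, ¬ B9LeafX (Y9OfRecord N θ₃ Mstar ops) := by
  obtain ⟨ops₀, -, -⟩ := exists_junkOps_b9LeafX_Y9OfRecord (N := N) θ₃ hadm Mstar
  exact ⟨fun x => { ops₀ x with E37 := { (ops₀ x).E37 with Converges := fun _ => False } },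
    not_b9LeafX_of_divergent θ₃ Mstar _ hℓ fun _ _ h => h⟩

/-- **THE BUNDLE-SLOT HYPOTHESIS IS UNSATISFIABLE** (the `hslot` of `s_N06_record₁₁CB10YZW(B8)(B12∕subB12)_of_bundleSlot` ∕ `s_N06_of_refines₁₁CB10YZW(B8)`): as soon as ONE
admissible Stage-3 parameter with `L ≥ 5` exists, «the extended leaf at EVERY operator layer» fails at the bad layer of `exists_ops_not_b9LeafX`.  Those closers are therefore
vacuous-as-typed OF RECORD (they were landed as the honest reading of the ∀-form, `N06AtRecord11CB10YZW` §3; the pointed ∃-faces are the content).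
[cite: Balaban1985BackgroundPropagators, Thms 3.1–3.15 pp.397–432 (bookkeeping)] -/
theorem bundleSlot_unsat (hadm : θ₃.toStage1Params.Admissible) (hℓ : 4 ≤ θ₃.ℓ₆) :
    ¬ ∀ (θ₃ : Stage3Params), θ₃.toStage1Params.Admissible → ∀ (Mstar : ℕ) (ops : OpsY N θ₃ Mstar), B9LeafX (Y9OfRecord N θ₃ Mstar ops) := by
  intro hslot
  obtain ⟨ops, hbad⟩ := exists_ops_not_b9LeafX (N := N) θ₃ 0 hadm hℓ
  exact hbad (hslot θ₃ hadm 0 ops)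

end AtBundle

/-! ## §2 the ∀-form stubs over the four-pin and the six-pin Stage-11 records are FALSE -/

section Records

variable {F : T4Family}

/-- **`S_N06 (₁₁CB10YZW)` IS FALSE** whenever one admissible Stage-11 parameter with its provisos, `γ > 0` and `L ≥ 5` exists: g0's `not_s_N06_record₁₁CB10YZW_of_badOps` with
its `hbad` DISCHARGED by the bad layer of §1 (referee ref-E's READ-9 recommendation).  The ∀-form over ₁₁CB10YZW was never an N06 target (`N06AtRecord11CB10YZW` §3); K1's
∃-currency faces are untouched. [cite: Balaban1985BackgroundPropagators, Thms 3.1–3.15 pp.397–432 (bookkeeping: the stub's ∀-form is refutable)] -/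
theorem not_s_N06_record₁₁CB10YZW (θ : Stage11Params F N) (h : θ.Provisos₁₁) (hθ : θ.Admissible) (hγ : 0 < θ.γ) (hℓ : 4 ≤ θ.ℓ₆) :
    ¬ S_N06 (fun F D w => IsRecordOfRecord₁₁CB10YZW F N D w) := by
  obtain ⟨ops, hbad⟩ := exists_ops_not_b9LeafX (N := N) θ.toStage3Params 0 hθ.1.1.1.1.1 hℓ
  exact not_s_N06_record₁₁CB10YZW_of_badOps θ h hθ hγ 0 ops hbad

/-- **`S_N06` AT THE SIX-PIN RECORD `IsRecordOfRecord₁₁CB10YZWB8B12` IS FALSE** under the same inhabitation hypotheses: the bad layer (with any [B12] ∕ [B8] ∕ [B11] ∕ [IV]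
layers — all residual types are inhabited) presents a six-pin record (built as in g32's `exists_world_isRecordOfRecord₁₁CB10YZWB8B12`) whose `b9` leaf IS the extended leaf at
the bad layer (`upOfRecord₅CS_view₁₁B12B8B10YZW_leaves`) while its in-edges `b4 b5 b6 b7` hold (`b4_b5_b6_b7_of_isRecordOfRecord₁₁CB10YZWB8` after g32's refinement).
[cite: Balaban1985BackgroundPropagators, Thms 3.1–3.15 pp.397–432; Balaban1987RG1, Lemma 4 p.280 (the [B12] pin; bookkeeping)] -/
theorem not_s_N06_record₁₁CB10YZWB8B12 (θ : Stage11Params F N) (h : θ.Provisos₁₁) (hθ : θ.Admissible) (hγ : 0 < θ.γ) (hℓ : 4 ≤ θ.ℓ₆) :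
    ¬ S_N06 (fun F D w => IsRecordOfRecord₁₁CB10YZWB8B12 F N D w) := by
  intro hS
  obtain ⟨ops, hbad⟩ := exists_ops_not_b9LeafX (N := N) θ.toStage3Params 0 hθ.1.1.1.1.1 hℓ
  obtain ⟨lam12⟩ := nonempty_residB12 F N θ.τ9.M
  obtain ⟨lam⟩ := nonempty_residB8 (θ := θ.toStage3Params)
  obtain ⟨ζ⟩ := nonempty_residZ F N
  obtain ⟨lamW⟩ := nonempty_residW F N
  obtain ⟨w₀⟩ := nonempty_worldP
  let w : WorldP :=
    { w₀ with
      C := (datumOfRecord₁₁ F N θ h).C, γ := θ.γ, L := (θ.L : ℝ), one_lt_L := by exact_mod_cast θ.hL.2,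
      up := fun P => upOfRecord₅CS F N (θ.view₁₁B12B8B10YZW F N lam12 lam 0 ops ζ lamW) P }
  have hw : IsRecordOfRecord₁₁CB10YZWB8B12 F N (datumOfRecord₁₁ F N θ h) w :=
    ⟨θ, h, lam12, lam, 0, ops, ζ, lamW, hθ, rfl, rfl, ⟨hγ, le_rfl⟩, rfl, fun _ => rfl⟩
  let P₀ : B12.RunParams := ⟨0, 0, 0⟩
  obtain ⟨h4, h5, h6, h7⟩ := b4_b5_b6_b7_of_isRecordOfRecord₁₁CB10YZWB8 (isRecordOfRecord₁₁CB10YZWB8_of_isRecordOfRecord₁₁CB10YZWB8B12 hw) P₀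
  have hb9 : (w.up P₀).b9 := hS F _ w hw P₀ h4 h5 h6 h7
  exact hbad ((upOfRecord₅CS_view₁₁B12B8B10YZW_leaves F N θ lam12 lam 0 ops ζ lamW P₀).2.2.2.1.1 hb9)

/-- **`S_N06` AT THE SIX-PIN RECORD `IsRecordOfRecord₁₁CB10YZWB8subB12` IS FALSE** under the same inhabitation hypotheses (the bad layer presents a record through g32's
`view₁₁B12B8subB10YZW`; leaves by `upOfRecord₅CS_view₁₁B12B8subB10YZW_leaves`, in-edges by `b4_b5_b6_b7_of_isRecordOfRecord₁₁CB10YZWB8subB12`).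
[cite: Balaban1985BackgroundPropagators, Thms 3.1–3.15 pp.397–432; Balaban1985RegularSpaces, Thm 8 p.101 (the [B8] pin over the sub-index; bookkeeping)] -/
theorem not_s_N06_record₁₁CB10YZWB8subB12 (θ : Stage11Params F N) (h : θ.Provisos₁₁) (hθ : θ.Admissible) (hγ : 0 < θ.γ) (hℓ : 4 ≤ θ.ℓ₆) :
    ¬ S_N06 (fun F D w => IsRecordOfRecord₁₁CB10YZWB8subB12 F N D w) := by
  intro hS
  obtain ⟨ops, hbad⟩ := exists_ops_not_b9LeafX (N := N) θ.toStage3Params 0 hθ.1.1.1.1.1 hℓ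
  obtain ⟨lam12⟩ := nonempty_residB12 F N θ.τ9.M
  obtain ⟨lam⟩ := nonempty_residB8 (θ := θ.toStage3Params)
  obtain ⟨ζ⟩ := nonempty_residZ F N
  obtain ⟨lamW⟩ := nonempty_residW F N
  obtain ⟨w₀⟩ := nonempty_worldP
  let w : WorldP :=
    { w₀ with
      C := (datumOfRecord₁₁ F N θ h).C, γ := θ.γ, L := (θ.L : ℝ), one_lt_L := by exact_mod_cast θ.hL.2,
      up := fun P => upOfRecord₅CS F N (θ.view₁₁B12B8subB10YZW F N lam12 lam 0 ops ζ lamW) P }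
  have hw : IsRecordOfRecord₁₁CB10YZWB8subB12 F N (datumOfRecord₁₁ F N θ h) w :=
    ⟨θ, h, lam12, lam, 0, ops, ζ, lamW, hθ, rfl, rfl, ⟨hγ, le_rfl⟩, rfl, fun _ => rfl⟩
  let P₀ : B12.RunParams := ⟨0, 0, 0⟩
  obtain ⟨h4, h5, h6, h7⟩ := b4_b5_b6_b7_of_isRecordOfRecord₁₁CB10YZWB8subB12 hw P₀
  have hb9 : (w.up P₀).b9 := hS F _ w hw P₀ h4 h5 h6 h7
  exact hbad ((upOfRecord₅CS_view₁₁B12B8subB10YZW_leaves F N θ lam12 lam 0 ops ζ lamW P₀).2.2.2.1.1 hb9)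

end Records

end Summit.QuantumFields.YangMills.BalabanUVNodes.N06AtRecord11ForallGuard

end
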